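import Summits.AnomalousDissipation.AnomalousDissipation.Theses.VirtualDissipation
import Summits.AnomalousDissipation.AnomalousDissipation.Theorems.TaylorCertificatesSteadyStatesLoudBoundedStubCompactnessSplit
import Summits.AnomalousDissipation.AnomalousDissipation.Theorems.TaylorCertificatesSteadyStatesLoudBoundedStubGpAdmissible
import HarnessLib

/-!
# Birth skeleton (BC3) — crux `VirtualDissipation.LambRigidGP` (stmt-AnomalousDissipation-15150)

Route `route-AnomalousDissipation-VirtualDissipation`, crux #2 (ν-FREE LAMB RIGIDITY OF THE GALLOWAY–PROCTOR
FORCE): there are `E ≥ 2` and `c, δ₀ > 0` such that every smooth divergence-free mean-zero `U` on `T³` with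
`∫|U|² ≤ E` and every residual bound `R ∈ [0, δ₀]` of the steady-Euler residual
`w ↦ ∫⟪(U·∇)U − f_GP, w⟫` (dual to `‖∇w‖₂`, over smooth div-free mean-zero tests) pay `c ≤ R‖∇U‖₂`;
`f_GP(x) = sin(2πx₃)e₁ + sin(2πx₁)e₂ + sin(2πx₂)e₃` is the inline sum of three Stokes modes of the route file.

This file is the route-level BIRTH CERTIFICATE skeleton of the crux (LENSES-v3 §2 BC3; registrar seat
`planner-skel-stmt-AnomalousDissipation-15150-0`, 2026-08-17, mode skeleton-register). It records the decomposition
the route header itself names (TWO-LAYER PLAN / rationale: "no quiet V-point + no Onsager dodger ⟹ RigidAt",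
glue LANDED and force-agnostic) as two NAMED PIECES at the energy level `E = 2` (the weakest level the crux admits;
the crux is antitone in `E`), and a SORRY-FREE composition through the landed Rellich glue:

* `stub_noQuietVStateGP` (Q) — NO QUIET `V`-STATE IN THE CLOSED 2-BALL. Every finite-enstrophy weak steady Euler
  state `v ∈ V = H ∩ H¹` of `f_GP` (`Torus.IsSteadyWeakSolution 0 f_GP v`: `(f_GP, w) + ∫ (v ⊗ v) : ∇w = 0` for all
  smooth div-free mean-zero `w`) has `‖v‖² > 2`. A Liouville / non-existence statement for forced steady Euler in
  `H¹` inside an energy ball (the exact-dodger enemy: `R = 0` is admissible in the crux, so the crux contains "no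
  smooth mean-zero steady Euler flow of `f_GP` with `∫|U|² ≤ 2`"; (Q) is its `H¹`-closure, which is what compactness
  produces). Open; census: no trigonometric-polynomial dodger of degree `≤ 7` (Cruxes/SteadyStatesLoudBounded).
* `stub_noOnsagerDodgerGP` (D) — NO ONSAGER DODGER AT LEVEL 2. Every bad sequence for `f_GP` (smooth admissible
  `u_n`, `∫|u_n|² ≤ 2`, residual bounds `R_n ≥ 0` with `R_n → 0` AND vanishing virtual dissipation
  `R_n √(gradNormSq u_n) → 0`) has NON-divergent enstrophy (`∃ B, gradNormSq u_n ≤ B` infinitely often). This is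
  the approximation-rate content of the crux (the convex-integration / laminate adversary: one-stage laminates
  saturate at Onsager rate ½, stationary Nash iterates have non-vanishing virtual dissipation on the admissible
  side) — the load-bearing, hardest piece.
* `LambRigidGP_of : (Q)-sig → (D)-sig → LambRigidGP` — SORRY-FREE (axioms propext / Classical.choice / Quot.sound):
  `f_GP` is smooth (landed `…Theorems.SteadyStatesLoudBounded.GpAdmissible.stub_gpAdmissible`, p85210), and the
  landed `…Theorems.SteadyStatesLoudBounded.CompactnessSplit.stub_compactnessSplit` (p85561; contrapositive +
  Rellich on `H`: a failing family `c = δ₀ = 1/(n+1)` is a bad sequence, (D) bounds its enstrophy along a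
  subsequence, `Torus.isCompact_setOf_eGradNormSq_le` extracts an `H`-limit `v ∈ V` with `‖v‖² ≤ 2`, which is a
  weak steady Euler state by norm-continuity of the tested Euler generator — enemy (Q)) yields `c, δ₀` at level
  `E = 2`; the crux follows with the witness `E := 2`.

Why the cut is not a seam: (Q) is a statement about EXACT `H¹` steady Euler states (no sequences, no rates), (D)
about ROUGH almost-solutions (divergent enstrophy is the only way a bad sequence may exist); neither gives the crux
alone — (D) misses the bounded-enstrophy bad sequences, whose exclusion is exactly (Q) after Rellich, and (Q) says
nothing about sequences with `‖∇u_n‖ → ∞`. Conversely the crux gives both ((D) vacuously; (Q) through the landed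
truncation residual `stub_truncationResidual`, p85500), so `LambRigidGP ⟺ (Q) ∧ (D)` modulo landed lemmas: a
genuine dichotomy split, the one the dead line lojasiewicz-lamb-floor-ladder (crux SteadyStatesLoudBounded, S3–S5)
built its force-agnostic glue for. One level up the two pieces merge: (D) at level 3 implies (Q) at level 2
(landed `stub_dodgerAssembly`, p89006: a quiet `V`-point of energy `< E` plus high-frequency wiggles is an Onsager
dodger at level `E`), which is the route's `k = 1` plan `NoOnsagerDodgerGP(3) → LambRigidGP`; at the sharp level
`E = 2` the two enemies are distinct and both are registered here.

Disproof used: none — `Cruxes/LambRigidGP/` had no `Disproof.lean`, no Ideas and no Lines at registration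
(`ledger crux ls stmt-AnomalousDissipation-15150`, 2026-08-17). Negatives index honoured: the six refuted statements
of the summit concern any-mean / state-wise energy statements (Galilean drift, unresolved beats); both stubs keep
the crux's MEAN-ZERO class and energy cap verbatim (the refuter's mutation note on this item: dropping mean-zero +
cap makes rigidity false by the Galilean dodger `U = s(1,1,1) − (cos2πx₃, cos2πx₁, cos2πx₂)/(2πs)`).

Imports: the route file, the two landed Theorems files named above, HarnessLib. NOTE FOR TENURE (route header,
CONE caveat): promoting this split to route level via `--split … --glue-by stub_compactnessSplit` re-imports
`Literature.Analysis.FluidPDE.{StatisticalSolution, EnergySpaceRellich, SteadyNavierStokesProofs,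
CylindricalGenerator}` into the ROUTE file; screen that module cone first (this skeleton lives under Cruxes/ and
does not touch the route file's cone).
-/

-- `Summit.<Summit>.<Problem>` is the tree's mandated summit-side namespace (CONVENTIONS §2); single-conjunct summit, duplicate deliberate.
set_option linter.dupNamespace false

noncomputable section

namespace Summit.AnomalousDissipation.AnomalousDissipation.Cruxes.LambRigidGP.Birth

open MeasureTheory Filter Topology UnitAddTorus
open scoped InnerProductSpace ENNReal

/-! ## Stubs -/

/-- **(Q) `stub_noQuietVStateGP`** — NO QUIET `V`-STATE OF `f_GP` IN THE CLOSED ENERGY BALL OF LEVEL 2: every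
finite-enstrophy weak steady Euler state `v ∈ V` of the Galloway–Proctor force (`⟨F(v), w⟩ = (f_GP, w) +
∫ (v ⊗ v) : ∇w = 0` for every smooth divergence-free mean-zero `w`) has energy `‖v‖² > 2`. Open (forced steady
Euler Liouville statement in `H¹` inside an energy ball); size L–XL. Why plausibly true: no exact trigonometric-
polynomial dodger of `f_GP` of degree `≤ 7`, quiet-point searches plateau at residual `≈ 7·10⁻³` (energy `≈ 0.6`,
kit j014325/j015296) and `0.030` at energy `2.31` (j013184); `f_GP` is off the magic cone (mode-wise curl test) and
off its linear-phase enlargement (refuter review of this item, 2026-08-16). [FoiasManleyRosaTemam2001, Ch. II §7;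
arXiv:1401.4301; arXiv:2501.13632] -/
theorem stub_noQuietVStateGP :
    ∀ u : Literature.Analysis.FunctionSpaces.Torus.energySpace (Fin 3),
      (u : Lp (EuclideanSpace ℝ (Fin 3)) 2 (volume : Measure (UnitAddTorus (Fin 3)))) ∈
          Literature.Analysis.FunctionSpaces.Torus.energySpaceV (Fin 3) →
        Literature.Analysis.FluidPDE.Torus.IsSteadyWeakSolution 0
          (fun x : UnitAddTorus (Fin 3) => (Literature.Analysis.FluidPDE.Torus.stokesMode (Pi.single (2 : Fin 3) (1 : ℤ)) (EuclideanSpace.single (0 : Fin 3) (1 : ℝ)) false x + Literature.Analysis.FluidPDE.Torus.stokesMode (Pi.single (0 : Fin 3) (1 : ℤ)) (EuclideanSpace.single (1 : Fin 3) (1 : ℝ)) false x + Literature.Analysis.FluidPDE.Torus.stokesMode (Pi.single (1 : Fin 3) (1 : ℤ)) (EuclideanSpace.single (2 : Fin 3) (1 : ℝ)) false x : EuclideanSpace ℝ (Fin 3))) u →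
        2 < ‖u‖ ^ 2 := by
  sorry

/-- **(D) `stub_noOnsagerDodgerGP`** — NO ONSAGER DODGER OF `f_GP` AT LEVEL 2: every bad sequence (smooth
divergence-free mean-zero `u_n` with `∫|u_n|² ≤ 2`, residual bounds `R_n ≥ 0` of `w ↦ ∫⟪(u_n·∇)u_n − f_GP, w⟫`
dual to `‖∇w‖₂`, with `R_n → 0` and vanishing virtual dissipation `R_n‖∇u_n‖₂ → 0`) has NON-divergent enstrophy:
some level `B` is undershot infinitely often. The load-bearing piece (inverse theorem of approximation for the
quadratic Lamb map below the Onsager rate; adversary = compensated-compactness / convex-integration bookkeeping: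
one-stage laminates saturate at rate ½, only single modulated shear waves fake a force to `O(λ⁻³)` and they reach
exactly the magic cone, which excludes `f_GP`); open, size XL. Why it might fail = why the crux might (enlarged
magic cone with curved phases; `C^{σ>1/3}` standing flows of energy `≤ 2`). [arXiv:1401.4301; arXiv:2405.08390;
arXiv:2501.13632; doi:10.3934/cpaa.2012.11.1661; arXiv:1710.05205] -/
theorem stub_noOnsagerDodgerGP :
    ∀ (u : ℕ → UnitAddTorus (Fin 3) → EuclideanSpace ℝ (Fin 3)) (R : ℕ → ℝ),
      (∀ n : ℕ, Literature.Analysis.FunctionSpaces.Torus.IsSmooth (u n) ∧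
          Literature.Analysis.FunctionSpaces.Torus.IsDivFree (u n) ∧
          Literature.Analysis.FunctionSpaces.Torus.HasZeroMean (u n) ∧
          ∫ x, ‖u n x‖ ^ 2 ≤ (2 : ℝ) ∧ 0 ≤ R n ∧
          ∀ w : UnitAddTorus (Fin 3) → EuclideanSpace ℝ (Fin 3),
            Literature.Analysis.FunctionSpaces.Torus.IsSmooth w → Literature.Analysis.FunctionSpaces.Torus.IsDivFree w →
            Literature.Analysis.FunctionSpaces.Torus.HasZeroMean w →
            |∫ x, inner ℝ (Literature.Analysis.FunctionSpaces.Torus.convect (u n) (u n) x - (Literature.Analysis.FluidPDE.Torus.stokesMode (Pi.single (2 : Fin 3) (1 : ℤ)) (EuclideanSpace.single (0 : Fin 3) (1 : ℝ)) false x + Literature.Analysis.FluidPDE.Torus.stokesMode (Pi.single (0 : Fin 3) (1 : ℤ)) (EuclideanSpace.single (1 : Fin 3) (1 : ℝ)) false x + Literature.Analysis.FluidPDE.Torus.stokesMode (Pi.single (1 : Fin 3) (1 : ℤ)) (EuclideanSpace.single (2 : Fin 3) (1 : ℝ)) false x : EuclideanSpace ℝ (Fin 3))) (w x)| ≤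
              R n * Real.sqrt (Literature.Analysis.FunctionSpaces.Torus.gradNormSq w)) →
      Filter.Tendsto R Filter.atTop (nhds 0) →
      Filter.Tendsto (fun n => R n * Real.sqrt (Literature.Analysis.FunctionSpaces.Torus.gradNormSq (u n))) Filter.atTop (nhds 0) →
      ∃ B : ℝ, ∀ N : ℕ, ∃ n : ℕ, N ≤ n ∧ Literature.Analysis.FunctionSpaces.Torus.gradNormSq (u n) ≤ B := by
  sorry

/-! ## Name-keyed aliases of the two stub statements — the hypotheses of `LambRigidGP_of`

The native skeleton audit (`#h21_check_skeleton`, run by `ledger skeleton check`) admits a hypothesis of the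
composing theorem only if its head constant is a registered obligation or is NAMED like a declared stub;
`__Registered.stub_X` is the statement of `stub_X` verbatim under the stub's short name (device of
`Cruxes/CleanRoomInjectionFloor/Lines/birth.lean`, `Cruxes/CyclicWindLineLoud/Lines/birth.lean`). Each alias is an
`abbrev`, textually its stub's signature. -/
namespace __Registered

/-- Alias of the statement of `stub_noQuietVStateGP` (no quiet `V`-state of `f_GP` in the closed 2-ball), keyed by the stub name. -/
abbrev stub_noQuietVStateGP : Prop :=
  ∀ u : Literature.Analysis.FunctionSpaces.Torus.energySpace (Fin 3),
      (u : Lp (EuclideanSpace ℝ (Fin 3)) 2 (volume : Measure (UnitAddTorus (Fin 3)))) ∈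
          Literature.Analysis.FunctionSpaces.Torus.energySpaceV (Fin 3) →
        Literature.Analysis.FluidPDE.Torus.IsSteadyWeakSolution 0
          (fun x : UnitAddTorus (Fin 3) => (Literature.Analysis.FluidPDE.Torus.stokesMode (Pi.single (2 : Fin 3) (1 : ℤ)) (EuclideanSpace.single (0 : Fin 3) (1 : ℝ)) false x + Literature.Analysis.FluidPDE.Torus.stokesMode (Pi.single (0 : Fin 3) (1 : ℤ)) (EuclideanSpace.single (1 : Fin 3) (1 : ℝ)) false x + Literature.Analysis.FluidPDE.Torus.stokesMode (Pi.single (1 : Fin 3) (1 : ℤ)) (EuclideanSpace.single (2 : Fin 3) (1 : ℝ)) false x : EuclideanSpace ℝ (Fin 3))) u →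
        2 < ‖u‖ ^ 2

/-- Alias of the statement of `stub_noOnsagerDodgerGP` (no Onsager dodger of `f_GP` at level 2), keyed by the stub name. -/
abbrev stub_noOnsagerDodgerGP : Prop :=
  ∀ (u : ℕ → UnitAddTorus (Fin 3) → EuclideanSpace ℝ (Fin 3)) (R : ℕ → ℝ),
      (∀ n : ℕ, Literature.Analysis.FunctionSpaces.Torus.IsSmooth (u n) ∧
          Literature.Analysis.FunctionSpaces.Torus.IsDivFree (u n) ∧
          Literature.Analysis.FunctionSpaces.Torus.HasZeroMean (u n) ∧
          ∫ x, ‖u n x‖ ^ 2 ≤ (2 : ℝ) ∧ 0 ≤ R n ∧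
          ∀ w : UnitAddTorus (Fin 3) → EuclideanSpace ℝ (Fin 3),
            Literature.Analysis.FunctionSpaces.Torus.IsSmooth w → Literature.Analysis.FunctionSpaces.Torus.IsDivFree w →
            Literature.Analysis.FunctionSpaces.Torus.HasZeroMean w →
            |∫ x, inner ℝ (Literature.Analysis.FunctionSpaces.Torus.convect (u n) (u n) x - (Literature.Analysis.FluidPDE.Torus.stokesMode (Pi.single (2 : Fin 3) (1 : ℤ)) (EuclideanSpace.single (0 : Fin 3) (1 : ℝ)) false x + Literature.Analysis.FluidPDE.Torus.stokesMode (Pi.single (0 : Fin 3) (1 : ℤ)) (EuclideanSpace.single (1 : Fin 3) (1 : ℝ)) false x + Literature.Analysis.FluidPDE.Torus.stokesMode (Pi.single (1 : Fin 3) (1 : ℤ)) (EuclideanSpace.single (2 : Fin 3) (1 : ℝ)) false x : EuclideanSpace ℝ (Fin 3))) (w x)| ≤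
              R n * Real.sqrt (Literature.Analysis.FunctionSpaces.Torus.gradNormSq w)) →
      Filter.Tendsto R Filter.atTop (nhds 0) →
      Filter.Tendsto (fun n => R n * Real.sqrt (Literature.Analysis.FunctionSpaces.Torus.gradNormSq (u n))) Filter.atTop (nhds 0) →
      ∃ B : ℝ, ∀ N : ℕ, ∃ n : ℕ, N ≤ n ∧ Literature.Analysis.FunctionSpaces.Torus.gradNormSq (u n) ≤ B

end __Registered

/-! ## Composition -/

/-- **Composition** (kernel-checked, no `sorry` of its own): the two stub statements (as the name-keyed aliases
`__Registered.stub_*`) imply the crux `Summit.AnomalousDissipation.AnomalousDissipation.Theses.VirtualDissipation.LambRigidGP`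
BY NAME, with the energy witness `E := 2`. The implication is the landed, force-agnostic Rellich glue
`SteadyStatesLoudBounded.CompactnessSplit.stub_compactnessSplit` (p85561) at `f := f_GP`, `E := 2`, fed with the
smoothness of `f_GP` (`SteadyStatesLoudBounded.GpAdmissible.stub_gpAdmissible`, p85210). [bookkeeping over landed
lemmas; FoiasManleyRosaTemam2001 Ch. II §6–§7] -/
theorem LambRigidGP_of :
    __Registered.stub_noQuietVStateGP → __Registered.stub_noOnsagerDodgerGP →
      Summit.AnomalousDissipation.AnomalousDissipation.Theses.VirtualDissipation.LambRigidGP := by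
  intro hQ hD
  dsimp only [__Registered.stub_noQuietVStateGP, __Registered.stub_noOnsagerDodgerGP] at hQ hD
  obtain ⟨hfs, -, -⟩ :=
    Summit.AnomalousDissipation.AnomalousDissipation.Theorems.SteadyStatesLoudBounded.GpAdmissible.stub_gpAdmissible
  obtain ⟨c, δ₀, hc, hδ₀, hrig⟩ :=
    Summit.AnomalousDissipation.AnomalousDissipation.Theorems.SteadyStatesLoudBounded.CompactnessSplit.stub_compactnessSplit
      (fun x : UnitAddTorus (Fin 3) => (Literature.Analysis.FluidPDE.Torus.stokesMode (Pi.single (2 : Fin 3) (1 : ℤ)) (EuclideanSpace.single (0 : Fin 3) (1 : ℝ)) false x + Literature.Analysis.FluidPDE.Torus.stokesMode (Pi.single (0 : Fin 3) (1 : ℤ)) (EuclideanSpace.single (1 : Fin 3) (1 : ℝ)) false x + Literature.Analysis.FluidPDE.Torus.stokesMode (Pi.single (1 : Fin 3) (1 : ℤ)) (EuclideanSpace.single (2 : Fin 3) (1 : ℝ)) false x : EuclideanSpace ℝ (Fin 3)))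
      2 hfs hQ hD
  unfold Summit.AnomalousDissipation.AnomalousDissipation.Theses.VirtualDissipation.LambRigidGP
  exact ⟨2, c, δ₀, le_refl _, hc, hδ₀, hrig⟩

/-- WIRING CHECK: the two sorried stubs compose to a closed term of the crux's type (modulo their `sorry`s).
Deliberately an `example` (no constant enters the environment). -/
example : Summit.AnomalousDissipation.AnomalousDissipation.Theses.VirtualDissipation.LambRigidGP :=
  LambRigidGP_of stub_noQuietVStateGP stub_noOnsagerDodgerGP

end Summit.AnomalousDissipation.AnomalousDissipation.Cruxes.LambRigidGP.Birth

end
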